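import Mathlib.Computability.Primrec.List
import Literature.Computability.Complexity.PolyTimeCountable
import HarnessLib

/-!
# A primitive recursive interpreter for standard `TM2` machines

Companion of `PolyTimeCountable.lean` ("machines as strings", Arora–Barak 2009, §1.4). That file
COMPILES every bundled machine `M : Turing.TM2ComputableAux Γ₀ Γ₁` into a *standard machine*
`TM2Std.SCode` (stack index, label, state and symbol types all of the form `Fin _`, first-order
statements `TM2Std.SStmt`) simulating it step for step (`TM2Std.outputs_tr`). This file supplies
the other half of a universal machine, an INTERPRETER, and proves that it is *primitive
recursive* in Mathlib's sense (`Primrec`):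

* codes: a standard statement is coded by a `Nat.pair`-tree `UnivTM2.trCode q : ℕ` (constructor
  tag, `Encodable.encode`d tables of the finite functions involved, codes of the sub-statements);
  a configuration by `UnivTM2.encCfg C : Option ℕ × ℕ × List (List ℕ)` (label, state, stacks as
  lists of symbol numbers); a program by the list of its statement codes (`UnivTM2.encProg`);
* the interpreter: `UnivTM2.descend` walks one level down a statement tree while acting on
  (state, stacks); `UnivTM2.ustepAux` iterates it `code`-many times (enough: codes of
  sub-statements are smaller) and reads off the leaf (`goto`/`halt`); `UnivTM2.ustep prog` is one
  machine step on a coded configuration and `UnivTM2.urun prog C m` runs `m` steps, staying put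
  once halted; all of these are `Primrec` (`UnivTM2.primrec_descend`, `…primrec_ustep`,
  `…primrec_urun`);
* correctness: `UnivTM2.ustep_encCfg` (one step of the standard machine `c : SCode` is
  reproduced on codes), `UnivTM2.urun_of_iterate`, and `UnivTM2.urun_of_outputsInTime`: if `c`
  outputs `L'` on `L` within `m` steps (`Turing.TM2OutputsInTime`), running the interpreter for
  any `m' ≥ m` steps on the coded initial configuration yields the coded halting configuration,
  whose output stack holds `L'`.

This is the ingredient that makes oracle constructions over "the enumeration `M₁, M₂, …` of
all polynomial-time oracle machines" (Baker–Gill–Solovay 1975, §1) *effective*: see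
`OracleAlgEnumeration.lean` (a uniformly primitive recursive enumeration of all polynomial-time
oracle algorithms) and `BakerGillSolovayRecursive.lean` (the oracle `A` with `P^A = NP^A` is
recursive).

Mathlib has the universal partial recursive function `Nat.Partrec.Code.eval` and the simulation
of partial recursive functions BY `TM2` machines (`Turing.PartrecToTM2`), but no simulation of
Turing machines by (primitive/partial) recursive functions and no universal Turing machine
(searched `Computability/TMToPartrec`, `TuringMachine/*`, `PartrecCode`): the interpreter below
is new. Design: no dependent types on the coded side (everything is `ℕ` / `List ℕ`, junk values
on malformed codes), so that primitive recursiveness is a composition of Mathlib's `Primrec`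
API (`Primrec.nat_iterate`, `Primrec.list_set`, `Primrec.list_getD`, `Primrec.unpair`,
`Primrec.option_casesOn`, …); the dependent `TM2` side enters only in the simulation lemmas.

## References

* S. Arora, B. Barak, *Computational Complexity: A Modern Approach*, CUP 2009, §1.4 ("Machines
  as strings and the universal Turing machine"), Thm. 1.9 [AroraBarakCC2009].
* T. Baker, J. Gill, R. Solovay, *Relativizations of the P =? NP question*, SIAM J. Comput. 4
  (1975) 431–442, §1 (the enumeration of oracle machines) [BakerGillSolovay1975].
* Mathlib, `Mathlib/Computability/TuringMachine/StackTuringMachine.lean` (`Turing.TM2.stepAux`,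
  `Turing.TM2.step`), `Mathlib/Computability/Primrec/*.lean`.
-/

namespace Literature.Computability.Complexity

namespace UnivTM2

open Encodable

/-! ### Tables and their lookups -/

/-- Decoding a number into a table `List ℕ` (junk `[]`). [folklore] -/
def dl (n : ℕ) : List ℕ := (decode (α := List ℕ) n).getD []

/-- Decoding a number into a Boolean table `List Bool` (junk `[]`). [folklore] -/
def dlB (n : ℕ) : List Bool := (decode (α := List Bool) n).getD []

/-- Decoding a number into a two-argument table (junk `([], [])`). [folklore] -/
def dl2 (n : ℕ) : List ℕ × List (List ℕ) := (decode (α := List ℕ × List (List ℕ)) n).getD ([], [])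

/-- Table lookup (junk `0`). [folklore] -/
def lk (t : List ℕ) (v : ℕ) : ℕ := t.getD v 0

/-- Boolean table lookup (junk `false`). [folklore] -/
def lkB (t : List Bool) (v : ℕ) : Bool := t.getD v false

/-- Two-argument table lookup: the second argument is an optional stack symbol. [folklore] -/
def lk2 (t : List ℕ × List (List ℕ)) (v : ℕ) : Option ℕ → ℕ
  | none => t.1.getD v 0
  | some j => (t.2.getD v []).getD j 0

/-- `dl` is primitive recursive. [folklore] -/
theorem primrec_dl : Primrec dl :=
  Primrec.option_getD.comp Primrec.decode (Primrec.const [])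

/-- `dlB` is primitive recursive. [folklore] -/
theorem primrec_dlB : Primrec dlB :=
  Primrec.option_getD.comp Primrec.decode (Primrec.const [])

/-- `dl2` is primitive recursive. [folklore] -/
theorem primrec_dl2 : Primrec dl2 :=
  Primrec.option_getD.comp Primrec.decode (Primrec.const ([], []))

/-- `lk` is primitive recursive. [folklore] -/
theorem primrec_lk : Primrec₂ lk :=
  (Primrec.list_getD 0).comp Primrec.fst Primrec.snd

/-- `lkB` is primitive recursive. [folklore] -/
theorem primrec_lkB : Primrec₂ lkB :=
  (Primrec.list_getD false).comp Primrec.fst Primrec.snd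

/-- `lk2` is primitive recursive (composed form: no projections of tuples in the statement, which
keeps later unifications cheap). [folklore] -/
theorem primrec_lk2 {α : Type} [Primcodable α] {f : α → List ℕ × List (List ℕ)} {g : α → ℕ}
    {h : α → Option ℕ} (hf : Primrec f) (hg : Primrec g) (hh : Primrec h) :
    Primrec fun a => lk2 (f a) (g a) (h a) := by
  have H : Primrec (fun a => Option.casesOn (motive := fun _ => ℕ) (h a) ((f a).1.getD (g a) 0)
      (fun j => ((f a).2.getD (g a) []).getD j 0)) := by
    refine Primrec.option_casesOn hh ((Primrec.list_getD 0).comp (Primrec.fst.comp hf) hg) ?_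
    exact ((Primrec.list_getD 0).comp
      ((Primrec.list_getD []).comp (Primrec.snd.comp (hf.comp Primrec.fst)) (hg.comp Primrec.fst))
      Primrec.snd).to₂
  refine H.of_eq fun a => ?_
  cases h a <;> rfl

/-! ### One level of descent into a statement tree -/

/-- **One level of descent into a coded statement**, acting on (statement code, state, stacks):
by the constructor tag of the root — `load` (2) applies the state table, `branch` (3) selects a
sub-statement by the predicate table, `push` (4) / `peek` (5) / `pop` (6) act on the designated
stack and state — and moves to the code of the relevant sub-statement; leaves (`halt` 0, `goto` 1)
and malformed codes are fixed. This is `Turing.TM2.stepAux` one constructor at a time.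
[cite: AroraBarakCC2009, §1.4 (universal simulation)] -/
def descend (x : ℕ × ℕ × List (List ℕ)) : ℕ × ℕ × List (List ℕ) :=
  if x.1.unpair.1 = 2 then
    (x.1.unpair.2.unpair.2, lk (dl x.1.unpair.2.unpair.1) x.2.1, x.2.2)
  else if x.1.unpair.1 = 3 then
    (if lkB (dlB x.1.unpair.2.unpair.1) x.2.1 then x.1.unpair.2.unpair.2.unpair.1
      else x.1.unpair.2.unpair.2.unpair.2, x.2.1, x.2.2)
  else if x.1.unpair.1 = 4 then
    (x.1.unpair.2.unpair.2.unpair.2, x.2.1,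
      x.2.2.set x.1.unpair.2.unpair.1
        (lk (dl x.1.unpair.2.unpair.2.unpair.1) x.2.1 :: x.2.2.getD x.1.unpair.2.unpair.1 []))
  else if x.1.unpair.1 = 5 then
    (x.1.unpair.2.unpair.2.unpair.2,
      lk2 (dl2 x.1.unpair.2.unpair.2.unpair.1) x.2.1 (x.2.2.getD x.1.unpair.2.unpair.1 []).head?, x.2.2)
  else if x.1.unpair.1 = 6 then
    (x.1.unpair.2.unpair.2.unpair.2,
      lk2 (dl2 x.1.unpair.2.unpair.2.unpair.1) x.2.1 (x.2.2.getD x.1.unpair.2.unpair.1 []).head?,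
      x.2.2.set x.1.unpair.2.unpair.1 (x.2.2.getD x.1.unpair.2.unpair.1 []).tail)
  else x

/-- `descend` is primitive recursive. [folklore] -/
theorem primrec_descend : Primrec descend := by
  have p_t : Primrec (fun x : ℕ × ℕ × List (List ℕ) => x.1) := Primrec.fst
  have p_v : Primrec (fun x : ℕ × ℕ × List (List ℕ) => x.2.1) := Primrec.fst.comp Primrec.snd
  have p_S : Primrec (fun x : ℕ × ℕ × List (List ℕ) => x.2.2) := Primrec.snd.comp Primrec.snd
  have p_tag : Primrec (fun x : ℕ × ℕ × List (List ℕ) => x.1.unpair.1) := Primrec.fst.comp (Primrec.unpair.comp p_t)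
  have p_pl : Primrec (fun x : ℕ × ℕ × List (List ℕ) => x.1.unpair.2) := Primrec.snd.comp (Primrec.unpair.comp p_t)
  have p_a : Primrec (fun x : ℕ × ℕ × List (List ℕ) => x.1.unpair.2.unpair.1) := Primrec.fst.comp (Primrec.unpair.comp p_pl)
  have p_b : Primrec (fun x : ℕ × ℕ × List (List ℕ) => x.1.unpair.2.unpair.2) := Primrec.snd.comp (Primrec.unpair.comp p_pl)
  have p_ba : Primrec (fun x : ℕ × ℕ × List (List ℕ) => x.1.unpair.2.unpair.2.unpair.1) := Primrec.fst.comp (Primrec.unpair.comp p_b)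
  have p_bb : Primrec (fun x : ℕ × ℕ × List (List ℕ) => x.1.unpair.2.unpair.2.unpair.2) := Primrec.snd.comp (Primrec.unpair.comp p_b)
  have p_stk : Primrec (fun x : ℕ × ℕ × List (List ℕ) => x.2.2.getD x.1.unpair.2.unpair.1 []) := (Primrec.list_getD []).comp p_S p_a
  have p_eqc : ∀ c : ℕ, PrimrecPred (fun x : ℕ × ℕ × List (List ℕ) => x.1.unpair.1 = c) := fun c =>
    Primrec.eq.comp p_tag (Primrec.const c)
  have h2 : Primrec (fun x : ℕ × ℕ × List (List ℕ) => (x.1.unpair.2.unpair.2, lk (dl x.1.unpair.2.unpair.1) x.2.1, x.2.2)) :=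
    Primrec.pair p_b (Primrec.pair (primrec_lk.comp (primrec_dl.comp p_a) p_v) p_S)
  have h3c : PrimrecPred (fun x : ℕ × ℕ × List (List ℕ) => lkB (dlB x.1.unpair.2.unpair.1) x.2.1 = true) :=
    Primrec.eq.comp (primrec_lkB.comp (primrec_dlB.comp p_a) p_v) (Primrec.const true)
  have h3 : Primrec (fun x : ℕ × ℕ × List (List ℕ) =>
      (if lkB (dlB x.1.unpair.2.unpair.1) x.2.1 then x.1.unpair.2.unpair.2.unpair.1
        else x.1.unpair.2.unpair.2.unpair.2, x.2.1, x.2.2)) :=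
    Primrec.pair (Primrec.ite h3c p_ba p_bb) (Primrec.pair p_v p_S)
  have h4 : Primrec (fun x : ℕ × ℕ × List (List ℕ) => (x.1.unpair.2.unpair.2.unpair.2, x.2.1,
      x.2.2.set x.1.unpair.2.unpair.1
        (lk (dl x.1.unpair.2.unpair.2.unpair.1) x.2.1 :: x.2.2.getD x.1.unpair.2.unpair.1 []))) :=
    Primrec.pair p_bb (Primrec.pair p_v (Primrec.list_set.comp p_S (Primrec.pair p_a
      (Primrec.list_cons.comp (primrec_lk.comp (primrec_dl.comp p_ba) p_v) p_stk))))
  have hv : Primrec (fun x : ℕ × ℕ × List (List ℕ) =>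
      lk2 (dl2 x.1.unpair.2.unpair.2.unpair.1) x.2.1 (x.2.2.getD x.1.unpair.2.unpair.1 []).head?) :=
    primrec_lk2 (primrec_dl2.comp p_ba) p_v (Primrec.list_head?.comp p_stk)
  have h5 : Primrec (fun x : ℕ × ℕ × List (List ℕ) => (x.1.unpair.2.unpair.2.unpair.2,
      lk2 (dl2 x.1.unpair.2.unpair.2.unpair.1) x.2.1 (x.2.2.getD x.1.unpair.2.unpair.1 []).head?, x.2.2)) :=
    Primrec.pair p_bb (Primrec.pair hv p_S)
  have h6 : Primrec (fun x : ℕ × ℕ × List (List ℕ) => (x.1.unpair.2.unpair.2.unpair.2,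
      lk2 (dl2 x.1.unpair.2.unpair.2.unpair.1) x.2.1 (x.2.2.getD x.1.unpair.2.unpair.1 []).head?,
      x.2.2.set x.1.unpair.2.unpair.1 (x.2.2.getD x.1.unpair.2.unpair.1 []).tail)) :=
    Primrec.pair p_bb (Primrec.pair hv
      (Primrec.list_set.comp p_S (Primrec.pair p_a (Primrec.list_tail.comp p_stk))))
  unfold descend
  exact Primrec.ite (p_eqc 2) h2 (Primrec.ite (p_eqc 3) h3 (Primrec.ite (p_eqc 4) h4
    (Primrec.ite (p_eqc 5) h5 (Primrec.ite (p_eqc 6) h6 Primrec.id))))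


/-! ### Steps and runs -/

/-- Reading off the configuration reached at a leaf: tag `1` is `goto` (next label from the
table), anything else halts (label `none`). [cite: AroraBarakCC2009, §1.4] -/
def leafOut (x : ℕ × ℕ × List (List ℕ)) : Option ℕ × ℕ × List (List ℕ) :=
  if x.1.unpair.1 = 1 then (some (lk (dl x.1.unpair.2) x.2.1), x.2.1, x.2.2) else (none, x.2.1, x.2.2)

/-- Executing a whole coded statement: descend `t` times from `(t, v, S)` (enough, since codes of
sub-statements are smaller than `t`), then read off the leaf. [cite: AroraBarakCC2009, §1.4] -/
def ustepAux (x : ℕ × ℕ × List (List ℕ)) : Option ℕ × ℕ × List (List ℕ) :=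
  leafOut (descend^[x.1] x)

/-- **The interpreter's step**: one step of the coded machine with program `prog` (the list of
statement codes indexed by labels) on a coded configuration; `none` on a halted configuration
(label `none`), as for `Turing.TM2.step`. [cite: AroraBarakCC2009, §1.4] -/
def ustep (prog : List ℕ) (C : Option ℕ × ℕ × List (List ℕ)) :
    Option (Option ℕ × ℕ × List (List ℕ)) :=
  match C.1 with
  | none => none
  | some l => some (ustepAux (prog.getD l 0, C.2.1, C.2.2))

/-- **The interpreter**: run the coded machine for `m` steps from `C`, staying put once halted (so
that any budget `≥` the halting time yields the halting configuration). [cite: AroraBarakCC2009, §1.4, Thm. 1.9] -/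
def urun (prog : List ℕ) (C : Option ℕ × ℕ × List (List ℕ)) (m : ℕ) : Option ℕ × ℕ × List (List ℕ) :=
  (fun C => (ustep prog C).getD C)^[m] C

/-- `leafOut` is primitive recursive. [folklore] -/
theorem primrec_leafOut : Primrec leafOut := by
  unfold leafOut
  refine Primrec.ite (Primrec.eq.comp (Primrec.fst.comp (Primrec.unpair.comp Primrec.fst)) (Primrec.const 1))
    ?_ ?_
  · exact Primrec.pair (Primrec.option_some.comp
      (primrec_lk.comp (primrec_dl.comp (Primrec.snd.comp (Primrec.unpair.comp Primrec.fst)))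
        (Primrec.fst.comp Primrec.snd))) Primrec.snd
  · exact Primrec.pair (Primrec.const none) Primrec.snd

/-- `ustepAux` is primitive recursive (bounded iteration of `descend`). [folklore] -/
theorem primrec_ustepAux : Primrec ustepAux :=
  primrec_leafOut.comp (Primrec.nat_iterate Primrec.fst Primrec.id (primrec_descend.comp Primrec.snd).to₂)

/-- **The interpreter's step function is primitive recursive.** [cite: AroraBarakCC2009, §1.4] -/
theorem primrec_ustep : Primrec₂ ustep := by
  have h : Primrec (fun p : List ℕ × (Option ℕ × ℕ × List (List ℕ)) =>
      Option.casesOn (motive := fun _ => Option (Option ℕ × ℕ × List (List ℕ))) p.2.1 none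
        (fun l => some (ustepAux (p.1.getD l 0, p.2.2.1, p.2.2.2)))) := by
    have h2 : Primrec (fun q : (List ℕ × (Option ℕ × ℕ × List (List ℕ))) × ℕ =>
        some (ustepAux (q.1.1.getD q.2 0, q.1.2.2.1, q.1.2.2.2))) := by
      refine Primrec.option_some.comp (primrec_ustepAux.comp ?_)
      exact Primrec.pair ((Primrec.list_getD 0).comp (Primrec.fst.comp Primrec.fst) Primrec.snd)
        (Primrec.pair (Primrec.fst.comp (Primrec.snd.comp (Primrec.snd.comp Primrec.fst)))
          (Primrec.snd.comp (Primrec.snd.comp (Primrec.snd.comp Primrec.fst))))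
    exact Primrec.option_casesOn (Primrec.fst.comp Primrec.snd) (Primrec.const none) h2.to₂
  refine Primrec₂.mk (h.of_eq fun p => ?_)
  rcases p with ⟨prog, _ | l, v, S⟩ <;> rfl

/-- **The interpreter is primitive recursive**: `(prog, C, m) ↦ urun prog C m` (composed form).
[cite: AroraBarakCC2009, §1.4 (universal simulation), Thm. 1.9] -/
theorem primrec_urun {α : Type} [Primcodable α] {f : α → List ℕ} {g : α → Option ℕ × ℕ × List (List ℕ)}
    {h : α → ℕ} (hf : Primrec f) (hg : Primrec g) (hh : Primrec h) :
    Primrec fun a => urun (f a) (g a) (h a) := by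
  unfold urun
  refine Primrec.nat_iterate hh hg ?_
  exact (Primrec.option_getD.comp (primrec_ustep.comp (hf.comp Primrec.fst) Primrec.snd) Primrec.snd).to₂

/-! ### Coding standard machines -/

section Coding

open Turing TM2Std Function

variable {nK N nΛ nσ m : ℕ}

/-- The table of a function between finite types. [folklore] -/
def tab (f : Fin nσ → Fin m) : List ℕ := List.ofFn fun s => (f s : ℕ)

/-- The table of a Boolean predicate on a finite type. [folklore] -/
def tabB (p : Fin nσ → Bool) : List Bool := List.ofFn p

/-- The two tables of a transition function depending on an optional stack symbol. [folklore] -/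
def tab2 (f : Fin nσ → Option (Fin (N + 1)) → Fin nσ) : List ℕ × List (List ℕ) :=
  (List.ofFn fun s => (f s none : ℕ),
   List.ofFn fun s => List.ofFn fun j : Fin (N + 1) => (f s (some j) : ℕ))

/-- **The code of a standard statement**: a `Nat.pair`-tree with a constructor tag, the tables
of the finite functions involved, and the codes of the sub-statements. [cite: AroraBarak2009, §1.4] -/
def trCode : SStmt nK N nΛ nσ → ℕ
  | .halt => Nat.pair 0 0
  | .goto f => Nat.pair 1 (encode (tab f))
  | .load f q => Nat.pair 2 (Nat.pair (encode (tab f)) (trCode q))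
  | .branch p q₁ q₂ => Nat.pair 3 (Nat.pair (encode (tabB p)) (Nat.pair (trCode q₁) (trCode q₂)))
  | .push k f q => Nat.pair 4 (Nat.pair k (Nat.pair (encode (tab f)) (trCode q)))
  | .peek k f q => Nat.pair 5 (Nat.pair k (Nat.pair (encode (tab2 f)) (trCode q)))
  | .pop k f q => Nat.pair 6 (Nat.pair k (Nat.pair (encode (tab2 f)) (trCode q)))

/-- The code of a stack assignment: the list of the stacks, symbols as numbers. [folklore] -/
def encStk (S : Fin nK → List (Fin (N + 1))) : List (List ℕ) := List.ofFn fun k => (S k).map Fin.val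

/-- The code of a configuration of a standard machine. [folklore] -/
def encCfg (C : TM2.Cfg (fun _ : Fin nK => Fin (N + 1)) (Fin nΛ) (Fin nσ)) :
    Option ℕ × ℕ × List (List ℕ) :=
  (C.l.map Fin.val, C.var.val, encStk C.stk)

/-- The code of the program of a standard machine: the list of the codes of its statements. [folklore] -/
def encProg (c : SCode) : List ℕ := List.ofFn fun l => trCode (c.prog l)

/-! ### Lookup lemmas -/

/-- Decoding an encoded table. [folklore] -/
theorem dl_encode (l : List ℕ) : dl (encode l) = l := by simp [dl]

/-- Decoding an encoded Boolean table. [folklore] -/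
theorem dlB_encode (l : List Bool) : dlB (encode l) = l := by simp [dlB]

/-- Decoding an encoded two-argument table. [folklore] -/
theorem dl2_encode (t : List ℕ × List (List ℕ)) : dl2 (encode t) = t := by
  unfold dl2; rw [Encodable.encodek]; rfl

/-- Reading a tabulated function at a valid index. [folklore] -/
theorem getD_ofFn {α : Type} (g : Fin nσ → α) (v : Fin nσ) (d : α) : (List.ofFn g).getD v d = g v := by
  rw [List.getD_eq_getElem?_getD, List.getElem?_ofFn]
  simp [v.isLt]

/-- Looking up the table of a function gives its value. [folklore] -/
theorem lk_tab (f : Fin nσ → Fin m) (v : Fin nσ) : lk (tab f) v = f v :=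
  getD_ofFn _ v 0

/-- Looking up the table of a predicate gives its value. [folklore] -/
theorem lkB_tabB (p : Fin nσ → Bool) (v : Fin nσ) : lkB (tabB p) v = p v :=
  getD_ofFn _ v false

/-- Looking up the tables of a two-argument transition gives its value. [folklore] -/
theorem lk2_tab2 (f : Fin nσ → Option (Fin (N + 1)) → Fin nσ) (v : Fin nσ) (o : Option (Fin (N + 1))) :
    lk2 (tab2 f) v (o.map Fin.val) = f v o := by
  cases o with
  | none => exact getD_ofFn _ v 0
  | some j =>
    simp only [Option.map_some, lk2, tab2]
    rw [getD_ofFn]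
    exact getD_ofFn _ j 0

/-- The coded stack at a valid index. [folklore] -/
theorem encStk_getD (S : Fin nK → List (Fin (N + 1))) (k : Fin nK) :
    (encStk S).getD k [] = (S k).map Fin.val :=
  getD_ofFn _ k []

/-- The coded stack at a valid index (`simp`-normal form). [folklore] -/
@[simp] theorem encStk_getElem? (S : Fin nK → List (Fin (N + 1))) (k : Fin nK) :
    (encStk S)[(k : ℕ)]? = some ((S k).map Fin.val) := by
  simp [encStk]

/-- Coding commutes with writing a stack. [folklore] -/
theorem encStk_update (S : Fin nK → List (Fin (N + 1))) (k : Fin nK) (L : List (Fin (N + 1))) :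
    encStk (update S k L) = (encStk S).set k (L.map Fin.val) := by
  apply List.ext_getElem
  · simp [encStk]
  · intro i h₁ h₂
    simp only [encStk, List.getElem_ofFn, List.getElem_set]
    by_cases h : (k : ℕ) = i
    · subst h
      simp
    · rw [if_neg h, update_of_ne]
      exact fun h' => h (by rw [← h'])

/-- The coded program at a label is the code of that label's statement. [folklore] -/
theorem encProg_getD (c : SCode) (l : Fin c.nΛ) : (encProg c).getD l 0 = trCode (c.prog l) :=
  getD_ofFn _ l 0

/-! ### Descending along a coded statement -/

/-- `b < Nat.pair a b` as soon as `a > 0` (codes of sub-statements are smaller). [folklore] -/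
theorem lt_pair_of_pos {a : ℕ} (ha : 0 < a) (b : ℕ) : b < Nat.pair a b := by
  unfold Nat.pair
  split_ifs with h <;> nlinarith

/-- The sub-statement of `load` has a smaller code. [folklore] -/
theorem trCode_lt_load (f : Fin nσ → Fin nσ) (q : SStmt nK N nΛ nσ) : trCode q < trCode (.load f q) :=
  lt_of_le_of_lt (Nat.right_le_pair _ _) (lt_pair_of_pos (by norm_num) _)

/-- The first branch has a smaller code. [folklore] -/
theorem trCode_lt_branch_left (p : Fin nσ → Bool) (q₁ q₂ : SStmt nK N nΛ nσ) :
    trCode q₁ < trCode (.branch p q₁ q₂) :=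
  lt_of_le_of_lt ((Nat.left_le_pair _ _).trans (Nat.right_le_pair _ _)) (lt_pair_of_pos (by norm_num) _)

/-- The second branch has a smaller code. [folklore] -/
theorem trCode_lt_branch_right (p : Fin nσ → Bool) (q₁ q₂ : SStmt nK N nΛ nσ) :
    trCode q₂ < trCode (.branch p q₁ q₂) :=
  lt_of_le_of_lt ((Nat.right_le_pair _ _).trans (Nat.right_le_pair _ _)) (lt_pair_of_pos (by norm_num) _)

/-- The sub-statement of `push` has a smaller code. [folklore] -/
theorem trCode_lt_push (k : Fin nK) (f : Fin nσ → Fin (N + 1)) (q : SStmt nK N nΛ nσ) :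
    trCode q < trCode (.push k f q) :=
  lt_of_le_of_lt ((Nat.right_le_pair _ _).trans (Nat.right_le_pair _ _)) (lt_pair_of_pos (by norm_num) _)

/-- The sub-statement of `peek` has a smaller code. [folklore] -/
theorem trCode_lt_peek (k : Fin nK) (f : Fin nσ → Option (Fin (N + 1)) → Fin nσ) (q : SStmt nK N nΛ nσ) :
    trCode q < trCode (.peek k f q) :=
  lt_of_le_of_lt ((Nat.right_le_pair _ _).trans (Nat.right_le_pair _ _)) (lt_pair_of_pos (by norm_num) _)

/-- The sub-statement of `pop` has a smaller code. [folklore] -/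
theorem trCode_lt_pop (k : Fin nK) (f : Fin nσ → Option (Fin (N + 1)) → Fin nσ) (q : SStmt nK N nΛ nσ) :
    trCode q < trCode (.pop k f q) :=
  lt_of_le_of_lt ((Nat.right_le_pair _ _).trans (Nat.right_le_pair _ _)) (lt_pair_of_pos (by norm_num) _)

variable (v : Fin nσ) (S : Fin nK → List (Fin (N + 1)))

/-- `halt` is a leaf: `descend` fixes it. [folklore] -/
theorem descend_halt (w : ℕ) (S' : List (List ℕ)) :
    descend (trCode (.halt : SStmt nK N nΛ nσ), w, S') = (trCode (.halt : SStmt nK N nΛ nσ), w, S') := by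
  simp [descend, trCode]

/-- `goto` is a leaf: `descend` fixes it. [folklore] -/
theorem descend_goto (f : Fin nσ → Fin nΛ) (w : ℕ) (S' : List (List ℕ)) :
    descend (trCode (.goto f : SStmt nK N nΛ nσ), w, S') = (trCode (.goto f : SStmt nK N nΛ nσ), w, S') := by
  simp [descend, trCode]

/-- Descending through `load`: apply the state map. [cite: AroraBarakCC2009, §1.4] -/
theorem descend_load (f : Fin nσ → Fin nσ) (q : SStmt nK N nΛ nσ) :
    descend (trCode (.load f q), (v : ℕ), encStk S) = (trCode q, (f v : ℕ), encStk S) := by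
  simp [descend, trCode, dl_encode, lk_tab]

/-- Descending through `branch`: choose the sub-statement by the predicate. [cite: AroraBarakCC2009, §1.4] -/
theorem descend_branch (p : Fin nσ → Bool) (q₁ q₂ : SStmt nK N nΛ nσ) :
    descend (trCode (.branch p q₁ q₂), (v : ℕ), encStk S) =
      (if p v then trCode q₁ else trCode q₂, (v : ℕ), encStk S) := by
  simp [descend, trCode, dlB_encode, lkB_tabB]

/-- Descending through `push`: push the symbol given by the table. [cite: AroraBarakCC2009, §1.4] -/
theorem descend_push (k : Fin nK) (f : Fin nσ → Fin (N + 1)) (q : SStmt nK N nΛ nσ) :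
    descend (trCode (.push k f q), (v : ℕ), encStk S) = (trCode q, (v : ℕ), encStk (update S k (f v :: S k))) := by
  simp [descend, trCode, dl_encode, lk_tab, encStk_update]

/-- Descending through `peek`: update the state by the top symbol. [cite: AroraBarakCC2009, §1.4] -/
theorem descend_peek (k : Fin nK) (f : Fin nσ → Option (Fin (N + 1)) → Fin nσ) (q : SStmt nK N nΛ nσ) :
    descend (trCode (.peek k f q), (v : ℕ), encStk S) = (trCode q, (f v (S k).head? : ℕ), encStk S) := by
  simp [descend, trCode, dl2_encode, List.head?_map, lk2_tab2]

/-- Descending through `pop`: update the state by the top symbol and pop it. [cite: AroraBarakCC2009, §1.4] -/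
theorem descend_pop (k : Fin nK) (f : Fin nσ → Option (Fin (N + 1)) → Fin nσ) (q : SStmt nK N nΛ nσ) :
    descend (trCode (.pop k f q), (v : ℕ), encStk S) =
      (trCode q, (f v (S k).head? : ℕ), encStk (update S k (S k).tail)) := by
  simp [descend, trCode, dl2_encode, List.head?_map, lk2_tab2, encStk_update, List.map_tail]

/-! ### Simulation of statements, steps and runs -/

/-- Reading off a `halt` leaf. [folklore] -/
theorem leafOut_halt (w : ℕ) (S' : List (List ℕ)) :
    leafOut (trCode (.halt : SStmt nK N nΛ nσ), w, S') = (none, w, S') := by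
  simp [leafOut, trCode]

/-- Reading off a `goto` leaf: the next label from the table. [folklore] -/
theorem leafOut_goto (f : Fin nσ → Fin nΛ) :
    leafOut (trCode (.goto f : SStmt nK N nΛ nσ), (v : ℕ), encStk S) = (some (f v : ℕ), (v : ℕ), encStk S) := by
  simp [leafOut, trCode, dl_encode, lk_tab]

/-- **Executing a coded statement.** Descending at least `trCode q` times from
`(trCode q, v, S)` and reading off the leaf gives the code of `TM2.stepAux q v S`.
[cite: AroraBarak2009, §1.4] -/
theorem leafOut_iterate_descend : ∀ (q : SStmt nK N nΛ nσ) (v : Fin nσ) (S : Fin nK → List (Fin (N + 1)))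
    (n : ℕ), trCode q ≤ n →
      leafOut (descend^[n] (trCode q, (v : ℕ), encStk S)) = encCfg (TM2.stepAux q.toStmt v S)
  | .halt, v, S, n, _ => by
    rw [iterate_fixed (descend_halt _ _) n, leafOut_halt]
    rfl
  | .goto f, v, S, n, _ => by
    rw [iterate_fixed (descend_goto f _ _) n, leafOut_goto]
    rfl
  | .load f q, v, S, n, hn => by
    obtain ⟨n, rfl⟩ := Nat.exists_eq_add_one_of_ne_zero (n := n) (by
      have := trCode_lt_load f q; omega)
    rw [iterate_succ_apply, descend_load]
    have := trCode_lt_load (nK := nK) (N := N) (nΛ := nΛ) f q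
    exact leafOut_iterate_descend q (f v) S n (by omega)
  | .branch p q₁ q₂, v, S, n, hn => by
    obtain ⟨n, rfl⟩ := Nat.exists_eq_add_one_of_ne_zero (n := n) (by
      have := trCode_lt_branch_left p q₁ q₂; omega)
    rw [iterate_succ_apply, descend_branch]
    have h₁ := trCode_lt_branch_left (nK := nK) (N := N) (nΛ := nΛ) p q₁ q₂
    have h₂ := trCode_lt_branch_right (nK := nK) (N := N) (nΛ := nΛ) p q₁ q₂
    simp only [SStmt.toStmt, TM2.stepAux]
    cases p v with
    | true => exact leafOut_iterate_descend q₁ v S n (by omega)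
    | false => exact leafOut_iterate_descend q₂ v S n (by omega)
  | .push k f q, v, S, n, hn => by
    obtain ⟨n, rfl⟩ := Nat.exists_eq_add_one_of_ne_zero (n := n) (by
      have := trCode_lt_push k f q; omega)
    rw [iterate_succ_apply, descend_push]
    have := trCode_lt_push (nΛ := nΛ) k f q
    exact leafOut_iterate_descend q v _ n (by omega)
  | .peek k f q, v, S, n, hn => by
    obtain ⟨n, rfl⟩ := Nat.exists_eq_add_one_of_ne_zero (n := n) (by
      have := trCode_lt_peek k f q; omega)
    rw [iterate_succ_apply, descend_peek]
    have := trCode_lt_peek (nΛ := nΛ) k f q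
    exact leafOut_iterate_descend q _ S n (by omega)
  | .pop k f q, v, S, n, hn => by
    obtain ⟨n, rfl⟩ := Nat.exists_eq_add_one_of_ne_zero (n := n) (by
      have := trCode_lt_pop k f q; omega)
    rw [iterate_succ_apply, descend_pop]
    have := trCode_lt_pop (nΛ := nΛ) k f q
    exact leafOut_iterate_descend q _ _ n (by omega)

/-- Executing a coded statement in one go. [cite: AroraBarak2009, §1.4] -/
theorem ustepAux_trCode (q : SStmt nK N nΛ nσ) :
    ustepAux (trCode q, (v : ℕ), encStk S) = encCfg (TM2.stepAux q.toStmt v S) :=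
  leafOut_iterate_descend q v S (trCode q) le_rfl

variable (c : SCode)

/-- **Simulation of one step**: the interpreter's step on a coded configuration is the code of
the machine's step. [cite: AroraBarak2009, §1.4] -/
theorem ustep_encCfg (C : c.tm.Cfg) : ustep (encProg c) (encCfg C) = (c.tm.step C).map encCfg := by
  obtain ⟨_ | l, w, T⟩ := C
  · rfl
  · change some (ustepAux ((encProg c).getD l 0, (w : ℕ), encStk T)) =
      some (encCfg (TM2.stepAux (c.prog l).toStmt w T))
    rw [encProg_getD, ustepAux_trCode]

/-- **Simulation of runs**: an `n`-step run of the machine is reproduced by `n` steps of the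
interpreter on the codes. [cite: AroraBarak2009, §1.4] -/
theorem urun_of_iterate (n : ℕ) : ∀ C D : c.tm.Cfg, (flip bind c.tm.step)^[n] (some C) = some D →
    urun (encProg c) (encCfg C) n = encCfg D := by
  induction n with
  | zero =>
    intro C D h
    simp only [iterate_zero, id_eq, Option.some.injEq] at h
    subst h
    rfl
  | succ n ih =>
    intro C D h
    rw [TM2Comp.iterate_bind_succ] at h
    cases hC : c.tm.step C with
    | none => rw [hC, TM2Comp.iterate_bind_none] at h; cases h
    | some C' =>
      rw [hC] at h
      unfold urun at ih ⊢
      rw [iterate_succ_apply, ustep_encCfg, hC]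
      exact ih C' D h

/-- A halted coded configuration is a fixed point of the interpreter. [folklore] -/
theorem urun_of_halted {prog : List ℕ} {C : Option ℕ × ℕ × List (List ℕ)} (hC : C.1 = none) (m : ℕ) :
    urun prog C m = C := by
  obtain ⟨l, w, T⟩ := C
  cases hC
  exact iterate_fixed rfl m

/-- Runs with slack: after the machine has halted, the interpreter stays put. [folklore] -/
theorem urun_of_iterate_of_le {n m : ℕ} (hnm : n ≤ m) {C D : c.tm.Cfg}
    (h : (flip bind c.tm.step)^[n] (some C) = some D) (hD : D.l = none) :
    urun (encProg c) (encCfg C) m = encCfg D := by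
  obtain ⟨d, rfl⟩ := Nat.exists_eq_add_of_le hnm
  unfold urun
  rw [add_comm, iterate_add_apply]
  change urun (encProg c) (urun (encProg c) (encCfg C) n) d = encCfg D
  rw [urun_of_iterate c n C D h]
  exact urun_of_halted (by simp [encCfg, hD]) d

/-- The code of the empty stack assignment. [folklore] -/
theorem encStk_empty : encStk (fun _ : Fin nK => ([] : List (Fin (N + 1)))) = List.replicate nK [] := by
  simp [encStk, List.ofFn_const]

/-- The code of an initial configuration. [folklore] -/
theorem encCfg_initList (L : List (Fin (c.N + 1))) :
    encCfg (initList c.tm L) = (some (c.main : ℕ), (c.init : ℕ), (List.replicate c.nK []).set c.k₀ (L.map Fin.val)) := by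
  rw [TM2Comp.initList_eq]
  simp only [encCfg, Option.map_some]
  rw [encStk_update, encStk_empty]

/-- The code of a halting configuration. [folklore] -/
theorem encCfg_haltList (L : List (Fin (c.N + 1))) :
    encCfg (haltList c.tm L) = (none, (c.init : ℕ), (List.replicate c.nK []).set c.k₁ (L.map Fin.val)) := by
  rw [TM2Comp.haltList_eq]
  simp only [encCfg, Option.map_none]
  rw [encStk_update, encStk_empty]

/-- **The interpreter reproduces outputs**: if the standard machine `c` outputs `L'` on `L`
within `m` steps, then running the interpreter for `m' ≥ m` steps on the coded initial
configuration yields the coded halting configuration, whose output stack holds `L'`.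
[cite: AroraBarak2009, §1.4] -/
theorem urun_of_outputsInTime {L L' : List (Fin (c.N + 1))} {m m' : ℕ}
    (h : Nonempty (TM2OutputsInTime c.tm L (some L') m)) (hm : m ≤ m') :
    urun (encProg c) (some (c.main : ℕ), (c.init : ℕ), (List.replicate c.nK []).set c.k₀ (L.map Fin.val)) m' =
      (none, (c.init : ℕ), (List.replicate c.nK []).set c.k₁ (L'.map Fin.val)) := by
  obtain ⟨⟨⟨steps, hev⟩, hle⟩⟩ := h
  simp only [Option.map_some] at hev
  rw [← encCfg_initList, ← encCfg_haltList]
  refine urun_of_iterate_of_le c (hle.trans hm) hev ?_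
  rw [TM2Comp.haltList_eq]

/-- Reading the output stack off the coded halting configuration. [folklore] -/
theorem getD_set_replicate (k : Fin nK) (X : List ℕ) :
    ((List.replicate nK ([] : List ℕ)).set k X).getD k [] = X := by
  rw [List.getD_eq_getElem?_getD, List.getElem?_set_self (by simp)]
  rfl

end Coding

end UnivTM2


end Literature.Computability.Complexity
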